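import Literature.MathematicalPhysics.QuantumFieldTheory.Balaban1983to89.B9Eq3126EnergyBallTowerClosed
import Literature.MathematicalPhysics.QuantumFieldTheory.Balaban1983to89.B9Eq3130HessianSlotPerturbationDiagonal
import Literature.MathematicalPhysics.QuantumFieldTheory.Balaban1983to89.B9Eq3126KFloorSlotDiagonal
import Literature.MathematicalPhysics.QuantumFieldTheory.Balaban1983to89.B9Eq3126H1kLipschitzSlotDiagonal
import Literature.MathematicalPhysics.QuantumFieldTheory.Balaban1983to89.B9Eq3153FrakGkLipschitzSlotDiagonal
import Literature.MathematicalPhysics.QuantumFieldTheory.Balaban1983to89.B9Eq3120DeltaPiPrimeFormDiagonalClosed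

/-!
# `Balaban1983to89.B9Eq3126EnergyBallTowerPiClosed` — T. Bałaban, *Propagators for lattice gauge theories in a background field*, Commun. Math. Phys. **99**
# (1985) 389–434 [Balaban1985BackgroundPropagators] Thm 3.4 p. 400, Thm 3.11 p. 416, (3.122) ∕ (3.126) p. 420, (3.130) p. 421, Thm 3.13 ∕ (3.153) p. 426,
# with [Balaban1985Variational] (45)–(46) p. 285, (110)–(111) p. 294, AT `k = n+1` AVERAGING LEVELS ON PRINT's DIAGONAL `ηL^{n+1} = 1`: **THE `k`-LEVEL BALL
# IN THE ENERGY CURRENCY FOR PRINT's OWN LETTERS — the four Green's letters `G̃_k`, `H̃_kQ_kG̃_k`, `𝔊̃_k`, `H̃_k` of print's operator (3.122)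
# `Δ̃_{a,k}(U) = π_k†Δ^η(U)π_k + D_UR_kD*_U + Q_k*aQ_k` (`B9Eq3119DeltaPiTower.laplaceAkPi`, NAMED) are BOUNDED together with their flat `D`-rows and
# `G̃_k`, `𝔊̃_k`, `H̃_k` are LIPSCHITZ AT THE FLAT POINT in the flat energy norm, under ONE `∃ α₀ C` BEFORE EVERY LATTICE ∕ HEIGHT ∕ WEIGHT ∕ VOLUME ∕
# BACKGROUND BINDER, with the θ-letter, the `K⁻¹`-letter, the symmetry and the `‖Q_k‖`-letter INHABITED** (the owner's `B9Eq3126EnergyBallTowerClosed` for the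
# `Δ_π`-letters: plan v7 «the Δ_π port» CLOSED in the energy currency on the diagonal)

statement-level skeleton of published theorems with citation tags; proofs where landed; nothing here is a claim about the Yang–Mills mass gap

CITATION HEADER (lean-in-tree rule).  Audit cell `pub-balaban`, sub-cell `t4`, BINDER row NE9; filed by the row OWNER lineage `b2b-balaban-t4-ne9-p1`
(gen 88, plan v8 «the K̃-floor transfer + the π-junction»).  Sources READ first-hand by this lineage in the held text layer [Balaban1985BackgroundPropagators]
(`paper:balaban1985-cmp99-background-propagators`, journal page = PDF page + 388) pp. 400, 416, 419–421, 425–426; [Balaban1985Variational] pp. 285, 293–295.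

THE PRINT (verbatim, text layer).  p. 420: *«… G̃⁻¹ defined as G̃⁻¹ = Δ_π + DRD* + Q*aQ. … H B = G̃Q*(QG̃Q*)⁻¹B. (3.126) … the operator G̃ … differs from
the operator investigated in previous sections by the additional term Δ′_π, but we will prove that this term is a small perturbation of Δ_a, and that the
operator G̃ used in the above formula has all the properties formulated in Theorems 3.3, 3.10»*; p. 421: *«G̃ = G₀(I − Δ′_πG₀)⁻¹ (3.130)»*; p. 426, Thm 3.13:
*«If … U satisfies the regularity conditions (3.35), (3.36) for α₀ sufficiently small, then Theorems 3.3, 3.10, 3.11 hold for the propagator 𝔊»*.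

WHY THIS FILE (cell context; DIAGNOSIS D-ne9p1-g87-1, `g87/DELTA-PI-PROGRAMME.md`).  The owner's junction `B9Eq3126EnergyBallTowerClosed` closed the `k`-level ball
for the CHAIN's letters = print's `G₀`-slot letters (p. 421).  Print's `H` (3.126), `𝔊` (3.153), [B11] (45), (110)–(111) — the letters that satisfy `Q𝔊 = 0`,
`RD*𝔊 = 0` — live on `G̃⁻¹ = Δ_π + DRD* + Q*aQ` (3.122), typed at `k` levels by `B9Eq3119DeltaPiTower.laplaceAkPi`; the port was typed piece by piece on the
diagonal (θ-letter: `B9Eq3120DeltaPiPrimeFormDiagonalClosed`; (3.130) in the slot: `B9Eq3130HessianSlotPerturbationDiagonal`; bounds: `B9Eq3153FrakGkBoundSlotDiagonal`;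
slot-Lipschitz rows: `B9Eq3126H1kLipschitzSlotDiagonal`, `B9Eq3153FrakGkLipschitzSlotDiagonal`; the `(QG̃Q*)⁻¹`-letter: `B9Eq3126KFloorSlotDiagonal`).  THIS file is
the JUNCTION of the port: every θ ∕ `C_K` ∕ `M_Q` ∕ symmetry hypothesis INHABITED, print's operator NAMED, flat reference letters the chain's at `U ≡ 1` (EQUALLY
print's there: `B9Eq3119DeltaPiTowerFlat.letters_laplaceAkPi_one`, not imported) — «THE k-LEVEL BALL FOR PRINT's LETTERS» = the chain's ball + `O(α)`.

WHAT IS PROVED (sorry-free; 0 `def`; [folklore] composition BY NAME + the triangle inequality + threshold arithmetic; nothing of [B9] asserted as printed).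
**`exists_energy_ball_pi_diagonal_closed`** — ONE `∃ α₀ C > 0` (`C` closed in `(d, a, a′, L, M_φ, M_φ′, r, C_τ, ρ_w)`) BEFORE every lattice ∕ height ∕ weight ∕ volume ∕
background binder; then for `0 ≤ α ≤ α₀`, UNITARY `U` with `U(b) ∈ U1` in the three windows (`‖U(b) − 1‖ ≤ αη`, `‖U(∂p) − 1‖ ≤ αη²`, `ε_j ≤ αr^j`), averaged bonds
`U^{(j)}(b) ∈ U1`, and ANY witnesses `hpos′` (the site operator `Δ′_{a′,k}(U)`, the letter `G′_k` of `π_k`), `hpos₁` (positivity of `laplaceAkPi … U a′ hpos′ …`),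
`hpos1`, `hQU`, `hQ1`: [G̃] rows of `G̃_k(U) = G1LatticeK hpos₁` `≤ C‖y‖` and `‖G̃_k(U)y − G_k(1)y‖ + rows ≤ Cα‖y‖`; [H̃QG̃] rows of `H̃_kQ_kG̃_ky ≤ C‖y‖`;
[𝔊̃] rows of `𝔊̃_k(U) = frakGLatticeK hpos₁ hQU` `≤ C‖x‖` and `‖𝔊̃_k(U)x − 𝔊_k(1)x‖ + rows ≤ Cα‖x‖`; [H̃] rows of `H̃_k(U) = H1LatticeK hpos₁ hQU` `≤ C‖b‖` and
`‖H̃_k(U)b − H_k(1)b‖ + rows ≤ Cα‖b‖`.  SUPPLIERS BY NAME, one `obtain` each: `exists_form_defect_piOfUk_diagonal_closed` (θ = θ̄·α; the slot left to unification),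
`exists_hessian_slot_perturbation_diagonal` (c), `exists_norm_G1k_slot_le_diagonal_closed` ∕ `exists_norm_H1k_Qk_G1k_slot_le_diagonal_closed` ∕
`exists_norm_frakGk_slot_le_diagonal_closed`, `exists_energy_letters_diagonal_closed` (the chain's positivity at `U`), `exists_norm_KinvLatticeK_H1LatticeK_le_diagonal_closed`
(`C_K`), `exists_norm_H1k_slot_sub_le_diagonal` ∕ `exists_norm_frakGk_slot_sub_le_diagonal`, `exists_KFloor_slot_diagonal`, `exists_energy_ball_diagonal_closed` (the chain's
flat-point rows); `M_Q = M_φ′M_φ·e^{Ξ∕(1−r)}` (`norm_QkW_one_le_canonical` + `norm_QkW_sub_flat_le_L2_geometric`, `Ξ = √(L^d)·√(2d)·102(d+1)²L`); `hRS` and the two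
symmetries from unitarity + the trace letters; `α₀` small enough that `θ̄α ≤ γ∕2` for each of the seven slot files; the Lipschitz rows by the triangle through the chain at `U`.

HONEST SCOPE.  Energy ∕ `L²` currency ONLY, on the diagonal; FIRST order at the flat point; no kernel bound (3.42)–(3.47), no decay (Thm 3.10), no Hölder norms, NOT
the (N)-reading ((117)'s product untouched); the WINDOWS, E162's data, unitarity, the trace letters, `ρ_w`, the averaged-bond membership and the five WITNESSES stay
HYPOTHESES (inhabited on the class by `B9Thm311LaplaceAkPiPositiveDiagonal`, `B9Thm311LaplaceAkPositiveDiagonal`, `QkW_surjective` — carried as binders so that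
consumers may plug their own); (3.124)'s `Q𝔊̃ = 0`, `RD*𝔊̃ = 0` NOT re-proved here (`B9Eq3119DeltaPiTower`, modulo (3.115)); the chart's re-instantiation at
`laplaceAkPi` NOT here (Support, INTERFACE REQUEST only); crude constants.  NOT summit progress (cell pub-balaban: NE9 NOT PRINTED ∕ NOT PROVED; «NE9 ⇐ the named
binders»; row WALLED ON A MODEL (O-NE9-1; #5 UNRULED); spine PROVED 0∕9; rung (B)+1 finite T⁴ — NOT infinite volume, NOT mass gap, NOT BetaPertH, NOT Clay).  HONEST
DEPENDENCY (cell line): continuum YM on T⁴ ⇐ BetaPertH ∧ nine spine estimates (0/9 proved); BetaPertH ⇐ (D1) ∧ (D4) ∧ CAP+tail; G-an2-4 gates asym, D1 and NE2/3/4.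
NEW file; nothing modified.  Net new unproved facts: 0.
-/

noncomputable section

open scoped InnerProductSpace ComplexConjugate BigOperators

namespace Literature.MathematicalPhysics.QuantumFieldTheory.Balaban1983to89.B9Eq3126EnergyBallTowerPiClosed

open B4Sect5Torus (TSite)
open B9SectCLatticeCarrier (Bond)
open B11Eq103H1Complex (SiteL2K BondL2K covDerivL2K covDivL2K laplaceALatticeK laplaceAK greenK G1LatticeK H1LatticeK frakGLatticeK KinvLatticeK
  adjoint_injective_of_surjective)
open B9Eq310HessianOperator (adTransportW hessOp covCurlL2K)
open B9Eq310HessianHermitian (adTransportW_adjoint)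
open B9Eq310DeltaPrime (plaqHolU)
open B9Eq315QTorus (perCfg cornerSite)
open B9Eq315QTower (towerP UlevOf)
open B9Eq315QTowerFlat (perCfg_UlevOf_one_mem_U1 norm_Wcx_UlevOf_one_sub_one_le)
open B9Eq315QTowerFlatNorm (norm_QkW_one_le_canonical)
open B9Eq315QTowerLipschitzL2 (norm_QkW_sub_flat_le_L2_geometric)
open B9Eq326OperatorTower (laplaceAk QkW RofUk laplaceAk_isSymmetric)
open B9Eq324DeltaPrimeATower (laplacePrimeAk GpOfUk)
open B9Eq3119DeltaPiTower (piOfUk laplaceAkPi laplaceAkPi_isSymmetric)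
open B7Prop1Explicit (U1 Wcx boxVec)
open B9Eq3153FrakGkBoundDiagonal (exists_energy_letters_diagonal_closed)
open B9Eq3153FrakGkBoundSlotDiagonal (exists_norm_G1k_slot_le_diagonal_closed exists_norm_H1k_Qk_G1k_slot_le_diagonal_closed
  exists_norm_frakGk_slot_le_diagonal_closed)
open B9Eq3130HessianSlotPerturbationDiagonal (exists_hessian_slot_perturbation_diagonal)
open B9Eq3126H1BoundTowerVariational (exists_norm_KinvLatticeK_H1LatticeK_le_diagonal_closed)
open B9Eq3126H1kLipschitzSlotDiagonal (exists_norm_H1k_slot_sub_le_diagonal)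
open B9Eq3153FrakGkLipschitzSlotDiagonal (exists_norm_frakGk_slot_sub_le_diagonal)
open B9Eq3126KFloorSlotDiagonal (exists_KFloor_slot_diagonal)
open B9Eq3126EnergyBallTowerClosed (exists_energy_ball_diagonal_closed)
open B9Eq3120DeltaPiPrimeFormDiagonalClosed (exists_form_defect_piOfUk_diagonal_closed)

/-! ## §0 Arithmetic and the triangle -/

/-- Weakening a row constant: `t ≤ Cᵢ·s`, `Cᵢ ≤ C`, `0 ≤ s` give `t ≤ C·s`. [folklore] -/
private theorem row_mono {t Ci C s : ℝ} (h : t ≤ Ci * s) (hC : Ci ≤ C) (hs : 0 ≤ s) : t ≤ C * s :=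
  h.trans (mul_le_mul_of_nonneg_right hC hs)

/-- The triangle through a middle letter under a linear map: `‖P(x − z)‖ ≤ ‖P(x − y)‖ + ‖P(y − z)‖`. [folklore] -/
private theorem norm_map_sub_tri {E F : Type*} [AddCommGroup E] [Module ℂ E] [SeminormedAddCommGroup F] [Module ℂ F]
    (P : E →ₗ[ℂ] F) (x y z : E) : ‖P (x - z)‖ ≤ ‖P (x - y)‖ + ‖P (y - z)‖ := by
  have h : x - z = (x - y) + (y - z) := by abel
  rw [h, map_add]; exact norm_add_le _ _

/-- Assembling an `α`-linear row from two pieces: `t ≤ A·θα·s + B·α·s`, `A·θ + B ≤ C` ⇒ `t ≤ C·α·s`. [folklore] -/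
private theorem row_lin {t A θ B C α s : ℝ} (h : t ≤ A * (θ * α) * s + B * α * s) (hC : A * θ + B ≤ C) (hα : 0 ≤ α) (hs : 0 ≤ s) :
    t ≤ C * α * s := by
  have h1 : A * (θ * α) * s + B * α * s = (A * θ + B) * α * s := by ring
  rw [h1] at h
  exact h.trans (mul_le_mul_of_nonneg_right (mul_le_mul_of_nonneg_right hC hα) hs)

variable {d : ℕ} (hd : 1 ≤ d) (L : ℕ) [NeZero L] (hL : 1 ≤ L)
  {𝔸 : Type*} [NormedRing 𝔸] [NormedAlgebra ℂ 𝔸] [CompleteSpace 𝔸] [NormOneClass 𝔸] [StarRing 𝔸] [NormedStarGroup 𝔸] [StarModule ℂ 𝔸]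
  {W : Type*} [NormedAddCommGroup W] [InnerProductSpace ℂ W] [FiniteDimensional ℂ W] (φ : W ≃ₗ[ℂ] 𝔸)
  {Mφ Mφ' : ℝ} (hMφ : 0 ≤ Mφ) (hMφ' : 0 ≤ Mφ') (hφ : ∀ w, ‖φ w‖ ≤ Mφ * ‖w‖) (hφ' : ∀ X, ‖φ.symm X‖ ≤ Mφ' * ‖X‖)
  {a : ℝ} (ha : 0 < a) {a' : ℝ} (ha' : 0 < a') {r : ℝ} (hr0 : 0 ≤ r) (hr1 : r < 1)
  (τ : 𝔸 →ₗ[ℂ] ℂ) {Cτ : ℝ} (hτ : ∀ X, ‖τ X‖ ≤ Cτ * ‖X‖) (hCτ : 0 ≤ Cτ) {ρw : ℝ} (hρw : 0 ≤ ρw)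
  (hτ₁ : ∀ X : 𝔸, τ (star X) = conj (τ X)) (hτ₂ : ∀ X Y : 𝔸, τ (X * Y) = τ (Y * X))
  (hφτ : ∀ X Y : 𝔸, ⟪φ.symm X, φ.symm Y⟫_ℂ = τ (star X * Y))

include hd hMφ hMφ' hφ hφ' ha ha' hr0 hr1 hτ hCτ hρw hτ₁ hτ₂ hφτ

/-! ## §1 The `k`-level ball for print's letters -/

-- deep definitional unfolding `laplaceAkPi` ↦ `laplaceALatticeK … (π†Δπ) …`, `G1LatticeK` ↦ `greenK` (as in `B9Eq3126EnergyBallTowerClosed`)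
set_option maxRecDepth 8192 in
set_option maxHeartbeats 800000 in
/-- **THE `k`-LEVEL BALL IN THE ENERGY CURRENCY FOR PRINT's LETTERS ON THE DIAGONAL, EVERY LETTER INHABITED** — see the module header: ONE `∃ α₀ C` before
every lattice ∕ height ∕ weight ∕ volume ∕ background binder; then for unitary `U` in the three windows, averaged bonds in `U1`, and ANY witnesses
`hpos′ hpos₁ hpos1 hQU hQ1`: [G̃] bounds and flat-point Lipschitz rows of `G̃_k`, [H̃QG̃] rows of `H̃_kQ_kG̃_k`, [𝔊̃] bounds and Lipschitz rows of `𝔊̃_k`,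
[H̃] bounds and Lipschitz rows of `H̃_k` — print's letters of (3.122) ∕ (3.126) ∕ (3.153), `laplaceAkPi` NAMED — in the flat energy norm, the flat reference
letters the chain's at `U ≡ 1`.  Composition by name; the triangle through the chain's letters at `U`. [folklore]
[cite: Balaban1985BackgroundPropagators, Thm 3.4 p.400, Thm 3.11 p.416, (3.122) p.420, (3.126) p.420, (3.130) p.421, Thm 3.13 p.426, (3.153) p.426; Balaban1985Variational, (45)–(46) p.285, (110)–(111) p.294] -/
theorem exists_energy_ball_pi_diagonal_closed :
    ∃ α₀ C : ℝ, 0 < α₀ ∧ 0 < C ∧ ∀ (n : ℕ) (η : ℝ), η * (L : ℝ) ^ (n + 1) = 1 → 3 ≤ L ^ (n + 1) →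
      ∀ (c₀ c₁ : ℝ) [Fact (0 < c₀)] [Fact (0 < c₁)], c₀ * ((L : ℝ) ^ (n + 1)) ^ d = c₁ → |η| ^ d / c₀ ≤ ρw →
      ∀ (m : Fin d → ℕ) [∀ i, NeZero (m i)] (U : Bond d (towerP L m (n + 1)) → 𝔸ˣ) (αU : ℕ → ℝ) (hα1 : ∀ j, αU j ≤ 1 / 64)
        (hU1 : ∀ (j : ℕ) (x : B7Prop1Explicit.Site d) (κ : Fin d), perCfg (towerP L m (j + 1)) (UlevOf L m (n + 1) U j) x κ ∈ U1 𝔸)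
        (hreg : ∀ (j : ℕ) (y : TSite d (towerP L m j)) (κ : Fin d) (r : Fin d → Fin L),
          ‖((Wcx L (perCfg (towerP L m (j + 1)) (UlevOf L m (n + 1) U j)) (cornerSite L y) κ (boxVec L r) : 𝔸ˣ) : 𝔸) - 1‖ ≤ αU j)
        (εU : ℕ → ℝ), (∀ j, 0 ≤ εU j) → (∀ (j : ℕ) (b : Bond d (towerP L m (j + 1))), ‖(UlevOf L m (n + 1) U j b : 𝔸) - 1‖ ≤ εU j) →
      ∀ {α : ℝ}, 0 ≤ α → α ≤ α₀ →
        (∀ b, star (U b : 𝔸) = (((U b)⁻¹ : 𝔸ˣ) : 𝔸)) →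
        (∀ b, U b ∈ U1 𝔸) → (∀ b, ‖(U b : 𝔸) - 1‖ ≤ α * η) →
        (∀ p : B9SectCLatticeCarrier.Plaq d (towerP L m (n + 1)), ‖(plaqHolU U p : 𝔸) - 1‖ ≤ α * η ^ 2) →
        (∀ j < n + 1, εU j ≤ α * r ^ j) →
        (∀ (j : ℕ) (b : Bond d (towerP L m (j + 1))), UlevOf L m (n + 1) U j b ∈ U1 𝔸) →
        ∀ (hpos' : ∀ x : SiteL2K ℂ d (towerP L m (n + 1)) c₀ W, x ≠ 0 → 0 < RCLike.re ⟪x, laplacePrimeAk L m n φ η U a' (c₁ := c₁) x⟫_ℂ)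
          (hpos₁ : ∀ x : BondL2K ℂ d (towerP L m (n + 1)) c₀ W, x ≠ 0 →
            0 < RCLike.re ⟪x, laplaceAkPi L m n φ τ η U a' hpos' hL αU hα1 hU1 hreg (c₁ := c₁) a x⟫_ℂ)
          (hpos1 : ∀ x : BondL2K ℂ d (towerP L m (n + 1)) c₀ W, x ≠ 0 →
            0 < RCLike.re ⟪x, laplaceAk L m n φ η (fun _ : Bond d (towerP L m (n + 1)) => (1 : 𝔸ˣ)) hL (fun _ => 0) (fun _ => by norm_num)
              (perCfg_UlevOf_one_mem_U1 L m (n + 1)) (norm_Wcx_UlevOf_one_sub_one_le L m (n + 1) (fun _ => 0) (fun _ => le_rfl)) τ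
              (c₀ := c₀) (c₁ := c₁) a x⟫_ℂ)
          (hQU : Function.Surjective (QkW L m n φ U hL αU hα1 hU1 hreg (c₀ := c₀) (c₁ := c₁)))
          (hQ1 : Function.Surjective (QkW L m n φ (fun _ : Bond d (towerP L m (n + 1)) => (1 : 𝔸ˣ)) hL (fun _ => 0) (fun _ => by norm_num)
            (perCfg_UlevOf_one_mem_U1 L m (n + 1)) (norm_Wcx_UlevOf_one_sub_one_le L m (n + 1) (fun _ => 0) (fun _ => le_rfl)) (c₀ := c₀) (c₁ := c₁))),
        -- [G̃] print's Green's function `G̃_k(U) = (Δ̃_{a,k}(U))⁻¹`: bounds and Lipschitz rows at the flat point (flat reference: the chain's `G_k(1)`)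
        (∀ y : BondL2K ℂ d (towerP L m (n + 1)) c₀ W,
          ‖G1LatticeK hpos₁ y‖ ≤ C * ‖y‖ ∧
          ‖covCurlL2K ℂ c₀ ((η : ℂ))⁻¹ (adTransportW φ (fun _ : Bond d (towerP L m (n + 1)) => (1 : 𝔸ˣ)))
            (G1LatticeK hpos₁ y)‖ ≤ C * ‖y‖ ∧
          ‖covDivL2K ℂ c₀ ((η : ℂ))⁻¹ (adTransportW φ fun _ : Bond d (towerP L m (n + 1)) => (1 : 𝔸ˣ)⁻¹)
            (G1LatticeK hpos₁ y)‖ ≤ C * ‖y‖ ∧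
          ‖G1LatticeK hpos₁ y -
            greenK (laplaceAk L m n φ η (fun _ : Bond d (towerP L m (n + 1)) => (1 : 𝔸ˣ)) hL (fun _ => 0) (fun _ => by norm_num)
              (perCfg_UlevOf_one_mem_U1 L m (n + 1)) (norm_Wcx_UlevOf_one_sub_one_le L m (n + 1) (fun _ => 0) (fun _ => le_rfl)) τ
              (c₀ := c₀) (c₁ := c₁) a) hpos1 y‖ ≤ C * α * ‖y‖ ∧
          ‖covCurlL2K ℂ c₀ ((η : ℂ))⁻¹ (adTransportW φ (fun _ : Bond d (towerP L m (n + 1)) => (1 : 𝔸ˣ)))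
            (G1LatticeK hpos₁ y -
            greenK (laplaceAk L m n φ η (fun _ : Bond d (towerP L m (n + 1)) => (1 : 𝔸ˣ)) hL (fun _ => 0) (fun _ => by norm_num)
              (perCfg_UlevOf_one_mem_U1 L m (n + 1)) (norm_Wcx_UlevOf_one_sub_one_le L m (n + 1) (fun _ => 0) (fun _ => le_rfl)) τ
              (c₀ := c₀) (c₁ := c₁) a) hpos1 y)‖ ≤ C * α * ‖y‖ ∧
          ‖covDivL2K ℂ c₀ ((η : ℂ))⁻¹ (adTransportW φ fun _ : Bond d (towerP L m (n + 1)) => (1 : 𝔸ˣ)⁻¹)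
            (G1LatticeK hpos₁ y -
            greenK (laplaceAk L m n φ η (fun _ : Bond d (towerP L m (n + 1)) => (1 : 𝔸ˣ)) hL (fun _ => 0) (fun _ => by norm_num)
              (perCfg_UlevOf_one_mem_U1 L m (n + 1)) (norm_Wcx_UlevOf_one_sub_one_le L m (n + 1) (fun _ => 0) (fun _ => le_rfl)) τ
              (c₀ := c₀) (c₁ := c₁) a) hpos1 y)‖ ≤ C * α * ‖y‖) ∧
        -- [H̃QG̃] the middle piece of (3.153) for print's letters: rows of `H̃_k(U)Q_k(U)G̃_k(U)`
        (∀ y : BondL2K ℂ d (towerP L m (n + 1)) c₀ W,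
          ‖H1LatticeK hpos₁ hQU (QkW L m n φ U hL αU hα1 hU1 hreg (c₁ := c₁) (G1LatticeK hpos₁ y))‖ ≤ C * ‖y‖ ∧
          ‖covCurlL2K ℂ c₀ ((η : ℂ))⁻¹ (adTransportW φ (fun _ : Bond d (towerP L m (n + 1)) => (1 : 𝔸ˣ)))
              (H1LatticeK hpos₁ hQU (QkW L m n φ U hL αU hα1 hU1 hreg (c₁ := c₁) (G1LatticeK hpos₁ y)))‖ ≤ C * ‖y‖ ∧
          ‖covDivL2K ℂ c₀ ((η : ℂ))⁻¹ (adTransportW φ fun _ : Bond d (towerP L m (n + 1)) => (1 : 𝔸ˣ)⁻¹)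
              (H1LatticeK hpos₁ hQU (QkW L m n φ U hL αU hα1 hU1 hreg (c₁ := c₁) (G1LatticeK hpos₁ y)))‖ ≤ C * ‖y‖) ∧
        -- [𝔊̃] print's third Green's letter `𝔊̃_k(U)` (3.153): bounds and Lipschitz rows at the flat point (flat reference: the chain's `𝔊_k(1)`)
        (∀ x : BondL2K ℂ d (towerP L m (n + 1)) c₀ W,
          ‖frakGLatticeK hpos₁ hQU x‖ ≤ C * ‖x‖ ∧
          ‖covCurlL2K ℂ c₀ ((η : ℂ))⁻¹ (adTransportW φ (fun _ : Bond d (towerP L m (n + 1)) => (1 : 𝔸ˣ))) (frakGLatticeK hpos₁ hQU x)‖ ≤ C * ‖x‖ ∧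
          ‖covDivL2K ℂ c₀ ((η : ℂ))⁻¹ (adTransportW φ fun _ : Bond d (towerP L m (n + 1)) => (1 : 𝔸ˣ)⁻¹) (frakGLatticeK hpos₁ hQU x)‖ ≤ C * ‖x‖ ∧
          ‖frakGLatticeK hpos₁ hQU x - frakGLatticeK (c := ((η : ℂ))⁻¹) (R := adTransportW φ (fun _ : Bond d (towerP L m (n + 1)) => (1 : 𝔸ˣ)))
              (S := adTransportW φ fun _ : Bond d (towerP L m (n + 1)) => (1 : 𝔸ˣ)⁻¹) (Δ₁ := hessOp φ η (fun _ : Bond d (towerP L m (n + 1)) => (1 : 𝔸ˣ)) τ)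
              (Rr := RofUk L m n φ η (fun _ : Bond d (towerP L m (n + 1)) => (1 : 𝔸ˣ)))
              (Q := (QkW L m n φ (fun _ : Bond d (towerP L m (n + 1)) => (1 : 𝔸ˣ)) hL (fun _ => 0) (fun _ => by norm_num)
            (perCfg_UlevOf_one_mem_U1 L m (n + 1)) (norm_Wcx_UlevOf_one_sub_one_le L m (n + 1) (fun _ => 0) (fun _ => le_rfl)) (c₀ := c₀) (c₁ := c₁))) (a := a) hpos1 hQ1 x‖ ≤ C * α * ‖x‖ ∧
          ‖covCurlL2K ℂ c₀ ((η : ℂ))⁻¹ (adTransportW φ (fun _ : Bond d (towerP L m (n + 1)) => (1 : 𝔸ˣ)))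
            (frakGLatticeK hpos₁ hQU x - frakGLatticeK (c := ((η : ℂ))⁻¹) (R := adTransportW φ (fun _ : Bond d (towerP L m (n + 1)) => (1 : 𝔸ˣ)))
              (S := adTransportW φ fun _ : Bond d (towerP L m (n + 1)) => (1 : 𝔸ˣ)⁻¹) (Δ₁ := hessOp φ η (fun _ : Bond d (towerP L m (n + 1)) => (1 : 𝔸ˣ)) τ)
              (Rr := RofUk L m n φ η (fun _ : Bond d (towerP L m (n + 1)) => (1 : 𝔸ˣ)))
              (Q := (QkW L m n φ (fun _ : Bond d (towerP L m (n + 1)) => (1 : 𝔸ˣ)) hL (fun _ => 0) (fun _ => by norm_num)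
            (perCfg_UlevOf_one_mem_U1 L m (n + 1)) (norm_Wcx_UlevOf_one_sub_one_le L m (n + 1) (fun _ => 0) (fun _ => le_rfl)) (c₀ := c₀) (c₁ := c₁))) (a := a) hpos1 hQ1 x)‖ ≤ C * α * ‖x‖ ∧
          ‖covDivL2K ℂ c₀ ((η : ℂ))⁻¹ (adTransportW φ fun _ : Bond d (towerP L m (n + 1)) => (1 : 𝔸ˣ)⁻¹)
            (frakGLatticeK hpos₁ hQU x - frakGLatticeK (c := ((η : ℂ))⁻¹) (R := adTransportW φ (fun _ : Bond d (towerP L m (n + 1)) => (1 : 𝔸ˣ)))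
              (S := adTransportW φ fun _ : Bond d (towerP L m (n + 1)) => (1 : 𝔸ˣ)⁻¹) (Δ₁ := hessOp φ η (fun _ : Bond d (towerP L m (n + 1)) => (1 : 𝔸ˣ)) τ)
              (Rr := RofUk L m n φ η (fun _ : Bond d (towerP L m (n + 1)) => (1 : 𝔸ˣ)))
              (Q := (QkW L m n φ (fun _ : Bond d (towerP L m (n + 1)) => (1 : 𝔸ˣ)) hL (fun _ => 0) (fun _ => by norm_num)
            (perCfg_UlevOf_one_mem_U1 L m (n + 1)) (norm_Wcx_UlevOf_one_sub_one_le L m (n + 1) (fun _ => 0) (fun _ => le_rfl)) (c₀ := c₀) (c₁ := c₁))) (a := a) hpos1 hQ1 x)‖ ≤ C * α * ‖x‖) ∧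
        -- [H̃] print's minimiser `H̃_k(U) = G̃Q*(QG̃Q*)⁻¹` (3.126): bounds and Lipschitz rows at the flat point (flat reference: the chain's `H_k(1)`)
        (∀ b : BondL2K ℂ d m c₁ W,
          ‖H1LatticeK hpos₁ hQU b‖ ≤ C * ‖b‖ ∧
          ‖covCurlL2K ℂ c₀ ((η : ℂ))⁻¹ (adTransportW φ (fun _ : Bond d (towerP L m (n + 1)) => (1 : 𝔸ˣ))) (H1LatticeK hpos₁ hQU b)‖ ≤ C * ‖b‖ ∧
          ‖covDivL2K ℂ c₀ ((η : ℂ))⁻¹ (adTransportW φ fun _ : Bond d (towerP L m (n + 1)) => (1 : 𝔸ˣ)⁻¹) (H1LatticeK hpos₁ hQU b)‖ ≤ C * ‖b‖ ∧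
          ‖H1LatticeK hpos₁ hQU b - H1LatticeK (c := ((η : ℂ))⁻¹) (R := adTransportW φ (fun _ : Bond d (towerP L m (n + 1)) => (1 : 𝔸ˣ)))
              (S := adTransportW φ fun _ : Bond d (towerP L m (n + 1)) => (1 : 𝔸ˣ)⁻¹) (Δ₁ := hessOp φ η (fun _ : Bond d (towerP L m (n + 1)) => (1 : 𝔸ˣ)) τ)
              (Rr := RofUk L m n φ η (fun _ : Bond d (towerP L m (n + 1)) => (1 : 𝔸ˣ)))
              (Q := (QkW L m n φ (fun _ : Bond d (towerP L m (n + 1)) => (1 : 𝔸ˣ)) hL (fun _ => 0) (fun _ => by norm_num)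
            (perCfg_UlevOf_one_mem_U1 L m (n + 1)) (norm_Wcx_UlevOf_one_sub_one_le L m (n + 1) (fun _ => 0) (fun _ => le_rfl)) (c₀ := c₀) (c₁ := c₁))) (a := a) hpos1 hQ1 b‖ ≤ C * α * ‖b‖ ∧
          ‖covCurlL2K ℂ c₀ ((η : ℂ))⁻¹ (adTransportW φ (fun _ : Bond d (towerP L m (n + 1)) => (1 : 𝔸ˣ)))
            (H1LatticeK hpos₁ hQU b - H1LatticeK (c := ((η : ℂ))⁻¹) (R := adTransportW φ (fun _ : Bond d (towerP L m (n + 1)) => (1 : 𝔸ˣ)))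
              (S := adTransportW φ fun _ : Bond d (towerP L m (n + 1)) => (1 : 𝔸ˣ)⁻¹) (Δ₁ := hessOp φ η (fun _ : Bond d (towerP L m (n + 1)) => (1 : 𝔸ˣ)) τ)
              (Rr := RofUk L m n φ η (fun _ : Bond d (towerP L m (n + 1)) => (1 : 𝔸ˣ)))
              (Q := (QkW L m n φ (fun _ : Bond d (towerP L m (n + 1)) => (1 : 𝔸ˣ)) hL (fun _ => 0) (fun _ => by norm_num)
            (perCfg_UlevOf_one_mem_U1 L m (n + 1)) (norm_Wcx_UlevOf_one_sub_one_le L m (n + 1) (fun _ => 0) (fun _ => le_rfl)) (c₀ := c₀) (c₁ := c₁))) (a := a) hpos1 hQ1 b)‖ ≤ C * α * ‖b‖ ∧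
          ‖covDivL2K ℂ c₀ ((η : ℂ))⁻¹ (adTransportW φ fun _ : Bond d (towerP L m (n + 1)) => (1 : 𝔸ˣ)⁻¹)
            (H1LatticeK hpos₁ hQU b - H1LatticeK (c := ((η : ℂ))⁻¹) (R := adTransportW φ (fun _ : Bond d (towerP L m (n + 1)) => (1 : 𝔸ˣ)))
              (S := adTransportW φ fun _ : Bond d (towerP L m (n + 1)) => (1 : 𝔸ˣ)⁻¹) (Δ₁ := hessOp φ η (fun _ : Bond d (towerP L m (n + 1)) => (1 : 𝔸ˣ)) τ)
              (Rr := RofUk L m n φ η (fun _ : Bond d (towerP L m (n + 1)) => (1 : 𝔸ˣ)))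
              (Q := (QkW L m n φ (fun _ : Bond d (towerP L m (n + 1)) => (1 : 𝔸ˣ)) hL (fun _ => 0) (fun _ => by norm_num)
            (perCfg_UlevOf_one_mem_U1 L m (n + 1)) (norm_Wcx_UlevOf_one_sub_one_le L m (n + 1) (fun _ => 0) (fun _ => le_rfl)) (c₀ := c₀) (c₁ := c₁))) (a := a) hpos1 hQ1 b)‖ ≤ C * α * ‖b‖) := by
  -- the suppliers, `∃`-first, BY NAME (level-free constants)
  obtain ⟨αθ, θb, hαθ, hθb, HΘ⟩ := exists_form_defect_piOfUk_diagonal_closed (d := d) L φ hMφ hMφ' hφ hφ' ha' hr0 hr1 τ hτ hCτ hρw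
  obtain ⟨α5, γ5, hα5, hγ5, H5⟩ := exists_hessian_slot_perturbation_diagonal (d := d) L hL φ hMφ hMφ' hφ hφ' ha hr0 hr1 τ hτ hCτ hρw
  obtain ⟨α82, γ82, C82, hα82, hγ82, hC82, H82⟩ := exists_norm_G1k_slot_le_diagonal_closed (d := d) L hL φ hMφ hMφ' hφ hφ' ha hr0 hr1 τ hτ hCτ hρw
  obtain ⟨α83, γ83, C83, hα83, hγ83, hC83, H83⟩ :=
    exists_norm_H1k_Qk_G1k_slot_le_diagonal_closed (d := d) L hL φ hMφ hMφ' hφ hφ' ha hr0 hr1 τ hτ hCτ hρw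
  obtain ⟨α84, γ84, C84, hα84, hγ84, hC84, H84⟩ := exists_norm_frakGk_slot_le_diagonal_closed (d := d) L hL φ hMφ hMφ' hφ hφ' ha hr0 hr1 τ hτ hCτ hρw
  obtain ⟨αE, γE, hαE, hγE, HE⟩ := exists_energy_letters_diagonal_closed (d := d) L hL φ hMφ hMφ' hφ hφ' ha hr0 hr1 τ hτ hCτ hρw
  obtain ⟨αK, CK, CH, hαK, hCK, hCH, HK⟩ :=
    exists_norm_KinvLatticeK_H1LatticeK_le_diagonal_closed hd L hL φ hMφ hMφ' hφ hφ' ha hr0 hr1 τ hτ hCτ hρw hτ₁ hτ₂ hφτ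
  obtain ⟨αF, γF, CF, hαF, hγF, hCF, HF⟩ := exists_norm_H1k_slot_sub_le_diagonal (d := d) L hL φ hMφ hMφ' hφ hφ' ha hr0 hr1 τ hτ hCτ hρw
  obtain ⟨α1, γ1, C1, hα1g, hγ1, hC1, H1⟩ := exists_KFloor_slot_diagonal (d := d) L hL φ hMφ hMφ' hφ hφ' ha hr0 hr1 τ hτ hCτ hρw
  obtain ⟨αJ, CJ, hαJ, hCJ, HJ⟩ := exists_energy_ball_diagonal_closed hd L hL φ hMφ hMφ' hφ hφ' ha hr0 hr1 τ hτ hCτ hρw hτ₁ hτ₂ hφτ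
  -- the `‖Q_k(U)‖`-letter `M_Q = M_φ′M_φ·e^{Ξ∕(1−r)}`, level-free
  have hL0 : (0 : ℝ) < L := by exact_mod_cast Nat.pos_of_ne_zero (NeZero.ne L)
  have h1r : 0 < 1 - r := by linarith
  obtain ⟨Ξ, hΞdef⟩ : ∃ Ξ : ℝ, Ξ = Real.sqrt ((L : ℝ) ^ d) * (Real.sqrt (2 * d) * (102 * (d + 1) ^ 2 * L)) := ⟨_, rfl⟩
  have hΞ0 : 0 ≤ Ξ := by rw [hΞdef]; positivity
  obtain ⟨MQ, hMQdef⟩ : ∃ MQ : ℝ, MQ = Mφ' * Mφ * Real.exp (Ξ / (1 - r)) := ⟨_, rfl⟩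
  have hMM : 0 ≤ Mφ' * Mφ := mul_nonneg hMφ' hMφ
  have hMQ : 0 ≤ MQ := by rw [hMQdef]; positivity
  obtain ⟨αF2, γF2, CF2, hαF2, hγF2, hCF2, HF2⟩ :=
    exists_norm_frakGk_slot_sub_le_diagonal (d := d) L hL φ hMφ hMφ' hφ hφ' ha hr0 hr1 τ hτ hCτ hρw hCK.le hMQ
  -- the θ-ceiling: `θ̄·α ≤ γ∕2` for the seven slot files
  obtain ⟨γm, hγmdef⟩ : ∃ γm : ℝ, γm = min (min (min γ5 γ82) (min γ83 γ84)) (min (min γF γF2) γ1) := ⟨_, rfl⟩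
  have hγm : 0 < γm := by rw [hγmdef]; exact lt_min (lt_min (lt_min hγ5 hγ82) (lt_min hγ83 hγ84)) (lt_min (lt_min hγF hγF2) hγ1)
  obtain ⟨hγm5, hγm82, hγm83, hγm84, hγmF, hγmF2, hγm1⟩ : γm ≤ γ5 ∧ γm ≤ γ82 ∧ γm ≤ γ83 ∧ γm ≤ γ84 ∧ γm ≤ γF ∧ γm ≤ γF2 ∧ γm ≤ γ1 := by
    rw [hγmdef]
    exact ⟨(min_le_left _ _).trans ((min_le_left _ _).trans (min_le_left _ _)), (min_le_left _ _).trans ((min_le_left _ _).trans (min_le_right _ _)),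
      (min_le_left _ _).trans ((min_le_right _ _).trans (min_le_left _ _)), (min_le_left _ _).trans ((min_le_right _ _).trans (min_le_right _ _)),
      (min_le_right _ _).trans ((min_le_left _ _).trans (min_le_left _ _)), (min_le_right _ _).trans ((min_le_left _ _).trans (min_le_right _ _)),
      (min_le_right _ _).trans (min_le_right _ _)⟩
  obtain ⟨αγ, hαγdef⟩ : ∃ αγ : ℝ, αγ = γm / (2 * θb) := ⟨_, rfl⟩
  have hαγ : 0 < αγ := by rw [hαγdef]; positivity
  -- one ceiling, one constant
  have hsCK : 0 ≤ Real.sqrt CK := Real.sqrt_nonneg _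
  obtain ⟨C, hCdef⟩ : ∃ C : ℝ, C = C82 + C83 + C84 + C1 * Real.sqrt CK + (2 / γ5 ^ 2 * θb + CJ) + (CF2 * θb + CJ) + (CF * Real.sqrt CK * θb + CJ) :=
    ⟨_, rfl⟩
  have hcHb : 0 ≤ C1 * Real.sqrt CK := mul_nonneg hC1.le hsCK
  obtain ⟨hcG, hc𝔊, hcH⟩ : 0 ≤ 2 / γ5 ^ 2 * θb + CJ ∧ 0 ≤ CF2 * θb + CJ ∧ 0 ≤ CF * Real.sqrt CK * θb + CJ := ⟨by positivity, by positivity, by positivity⟩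
  obtain ⟨h82C, h83C, h84C, hHbC, hGC, h𝔊C, hHC⟩ : C82 ≤ C ∧ C83 ≤ C ∧ C84 ≤ C ∧ C1 * Real.sqrt CK ≤ C ∧ 2 / γ5 ^ 2 * θb + CJ ≤ C ∧
      CF2 * θb + CJ ≤ C ∧ CF * Real.sqrt CK * θb + CJ ≤ C := by
    rw [hCdef]; refine ⟨?_, ?_, ?_, ?_, ?_, ?_, ?_⟩ <;> linarith [hC82.le, hC83.le, hC84.le]
  have hC : 0 < C := lt_of_lt_of_le hC82 h82C
  refine ⟨min (min (min (min αθ α5) (min α82 α83)) (min (min α84 αE) (min αK αF))) (min (min (min α1 αJ) (min αF2 αγ)) 1), C,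
    lt_min (lt_min (lt_min (lt_min hαθ hα5) (lt_min hα82 hα83)) (lt_min (lt_min hα84 hαE) (lt_min hαK hαF)))
      (lt_min (lt_min (lt_min hα1g hαJ) (lt_min hαF2 hαγ)) one_pos), hC, ?_⟩
  intro n η hηL hL3 c₀ c₁ _ _ hw hρ m _ U αU hα1 hU1 hreg εU hεU hUε α hα0 hαle hUst hUb hUη hpl hεg hUlev hpos' hpos₁ hpos1 hQU hQ1
  -- the ceilings
  have hαθ' : α ≤ αθ := hαle.trans ((min_le_left _ _).trans ((min_le_left _ _).trans ((min_le_left _ _).trans (min_le_left _ _))))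
  have hα5' : α ≤ α5 := hαle.trans ((min_le_left _ _).trans ((min_le_left _ _).trans ((min_le_left _ _).trans (min_le_right _ _))))
  have hα82' : α ≤ α82 := hαle.trans ((min_le_left _ _).trans ((min_le_left _ _).trans ((min_le_right _ _).trans (min_le_left _ _))))
  have hα83' : α ≤ α83 := hαle.trans ((min_le_left _ _).trans ((min_le_left _ _).trans ((min_le_right _ _).trans (min_le_right _ _))))
  have hα84' : α ≤ α84 := hαle.trans ((min_le_left _ _).trans ((min_le_right _ _).trans ((min_le_left _ _).trans (min_le_left _ _))))
  have hαE' : α ≤ αE := hαle.trans ((min_le_left _ _).trans ((min_le_right _ _).trans ((min_le_left _ _).trans (min_le_right _ _))))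
  have hαK' : α ≤ αK := hαle.trans ((min_le_left _ _).trans ((min_le_right _ _).trans ((min_le_right _ _).trans (min_le_left _ _))))
  have hαF' : α ≤ αF := hαle.trans ((min_le_left _ _).trans ((min_le_right _ _).trans ((min_le_right _ _).trans (min_le_right _ _))))
  have hα1' : α ≤ α1 := hαle.trans ((min_le_right _ _).trans ((min_le_left _ _).trans ((min_le_left _ _).trans (min_le_left _ _))))
  have hαJ' : α ≤ αJ := hαle.trans ((min_le_right _ _).trans ((min_le_left _ _).trans ((min_le_left _ _).trans (min_le_right _ _))))
  have hαF2' : α ≤ αF2 := hαle.trans ((min_le_right _ _).trans ((min_le_left _ _).trans ((min_le_right _ _).trans (min_le_left _ _))))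
  have hαγ' : α ≤ αγ := hαle.trans ((min_le_right _ _).trans ((min_le_left _ _).trans ((min_le_right _ _).trans (min_le_right _ _))))
  have hαone : α ≤ 1 := hαle.trans ((min_le_right _ _).trans (min_le_right _ _))
  -- `hRS` and the two symmetries from unitarity + the trace letters
  have hRS : ∀ (b : Bond d (towerP L m (n + 1))) (v u : W), ⟪adTransportW φ U b v, u⟫_ℂ = ⟪v, adTransportW φ (fun b => (U b)⁻¹) b u⟫_ℂ :=
    adTransportW_adjoint φ τ hτ₂ hUst hφτ
  have hsymmU := laplaceAk_isSymmetric L m n φ η U hL αU hα1 hU1 hreg τ (c₀ := c₀) (c₁ := c₁) hUst hτ₁ hτ₂ hφτ a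
  have hsymm₁ := laplaceAkPi_isSymmetric L m n φ τ η U a' hpos' hL αU hα1 hU1 hreg (c₁ := c₁) hUst hτ₁ hτ₂ hφτ a
  -- the θ-letter of print's slot: `θ = θ̄·α`, and its seven half-windows
  have hθ := HΘ n η hηL c₀ c₁ hw hρ m U hRS α hα0 hαθ' hUb hUη hpl εU hεU hεg hUε hUlev hpos'
  have hθ0 : 0 ≤ θb * α := mul_nonneg hθb.le hα0
  have hθm : θb * α ≤ γm / 2 := by
    have h1 : θb * α ≤ θb * αγ := mul_le_mul_of_nonneg_left hαγ' hθb.le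
    have h2 : θb * αγ = γm / 2 := by rw [hαγdef]; field_simp
    linarith
  obtain ⟨hθ5, hθ82, hθ83, hθ84, hθF, hθF2, hθ1⟩ : θb * α ≤ γ5 / 2 ∧ θb * α ≤ γ82 / 2 ∧ θb * α ≤ γ83 / 2 ∧ θb * α ≤ γ84 / 2 ∧ θb * α ≤ γF / 2 ∧
      θb * α ≤ γF2 / 2 ∧ θb * α ≤ γ1 / 2 :=
    ⟨hθm.trans (by linarith), hθm.trans (by linarith), hθm.trans (by linarith), hθm.trans (by linarith), hθm.trans (by linarith),
      hθm.trans (by linarith), hθm.trans (by linarith)⟩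
  -- the chain's positivity at `U` (any witness; from the strong coercivity)
  have HEx := HE n η hηL c₀ c₁ hw hρ m U αU hα1 hU1 hreg εU hεU hUε hα0 hαE' hRS hUb hUη hpl hεg
  have hposU : ∀ x : BondL2K ℂ d (towerP L m (n + 1)) c₀ W, x ≠ 0 →
      0 < RCLike.re ⟪x, laplaceAk L m n φ η U hL αU hα1 hU1 hreg τ (c₀ := c₀) (c₁ := c₁) a x⟫_ℂ := fun x hx => by
    have h := (HEx x).1
    have hx' : 0 < ‖x‖ := norm_pos_iff.2 hx
    have h2 : 0 < γE * (‖covCurlL2K ℂ c₀ ((η : ℂ))⁻¹ (adTransportW φ (fun _ : Bond d (towerP L m (n + 1)) => (1 : 𝔸ˣ))) x‖ ^ 2 +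
        ‖covDivL2K ℂ c₀ ((η : ℂ))⁻¹ (adTransportW φ fun _ : Bond d (towerP L m (n + 1)) => (1 : 𝔸ˣ)⁻¹) x‖ ^ 2 + ‖x‖ ^ 2) :=
      mul_pos hγE (add_pos_of_nonneg_of_pos (add_nonneg (sq_nonneg _) (sq_nonneg _)) (pow_pos hx' 2))
    linarith
  -- the `‖Q_k(U)‖`-letter on the diagonal
  have hc₁ : 0 < c₁ := Fact.out
  have hLr : (0 : ℝ) < (L : ℝ) ^ (n + 1) := pow_pos hL0 _
  have hηL0 : 0 < η * (L : ℝ) ^ (n + 1) := by rw [hηL]; exact one_pos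
  have hs : c₁ * (η * (L : ℝ) ^ (n + 1)) ^ 2 = c₀ * ((L : ℝ) ^ (n + 1)) ^ d := by rw [hηL, one_pow, mul_one, hw]
  have hratio : Real.sqrt (c₁ / (c₀ * ((L : ℝ) ^ (n + 1)) ^ d)) = 1 := by rw [hw, div_self hc₁.ne', Real.sqrt_one]
  have hQ1b : ∀ w : BondL2K ℂ d (towerP L m (n + 1)) c₀ W, ‖(QkW L m n φ (fun _ : Bond d (towerP L m (n + 1)) => (1 : 𝔸ˣ)) hL (fun _ => 0) (fun _ => by norm_num)
        (perCfg_UlevOf_one_mem_U1 L m (n + 1)) (norm_Wcx_UlevOf_one_sub_one_le L m (n + 1) (fun _ => 0) (fun _ => le_rfl)) (c₀ := c₀) (c₁ := c₁)) w‖ ≤ Mφ' * Mφ * ‖w‖ := fun w => by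
    have h := norm_QkW_one_le_canonical L m n hL φ hMφ hφ hMφ' hφ' (fun _ => 0) (fun _ => by norm_num)
      (perCfg_UlevOf_one_mem_U1 L m (n + 1)) (norm_Wcx_UlevOf_one_sub_one_le L m (n + 1) (fun _ => 0) (fun _ => le_rfl)) (c₀ := c₀)
      (c₁ := c₁) hηL0 hs w
    rw [hηL, inv_one, mul_one] at h
    exact h
  have hQd : ∀ w : BondL2K ℂ d (towerP L m (n + 1)) c₀ W, ‖(QkW L m n φ U hL αU hα1 hU1 hreg (c₀ := c₀) (c₁ := c₁)) w - (QkW L m n φ (fun _ : Bond d (towerP L m (n + 1)) => (1 : 𝔸ˣ)) hL (fun _ => 0) (fun _ => by norm_num)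
        (perCfg_UlevOf_one_mem_U1 L m (n + 1)) (norm_Wcx_UlevOf_one_sub_one_le L m (n + 1) (fun _ => 0) (fun _ => le_rfl)) (c₀ := c₀) (c₁ := c₁)) w‖ ≤
        Mφ' * Mφ * (Real.exp (Ξ * (α / (1 - r))) - 1) * ‖w‖ := fun w => by
    have h := norm_QkW_sub_flat_le_L2_geometric L m n hL φ hMφ hMφ' hφ hφ' (c₀ := c₀) (c₁ := c₁) U αU hα1 hU1 hreg εU hεU hUε hr0 hr1 hα0
      hεg w
    rw [hratio, mul_one, ← hΞdef] at h
    exact h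
  have hexp : Real.exp (Ξ * (α / (1 - r))) ≤ Real.exp (Ξ / (1 - r)) := by
    refine Real.exp_le_exp.2 ?_
    rw [mul_div_assoc']
    exact div_le_div_of_nonneg_right (mul_le_of_le_one_right hΞ0 hαone) h1r.le
  have hQUb : ∀ w : BondL2K ℂ d (towerP L m (n + 1)) c₀ W, ‖(QkW L m n φ U hL αU hα1 hU1 hreg (c₀ := c₀) (c₁ := c₁)) w‖ ≤ MQ * ‖w‖ := fun w => by
    have h1 := norm_le_insert' ((QkW L m n φ U hL αU hα1 hU1 hreg (c₀ := c₀) (c₁ := c₁)) w)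
      ((QkW L m n φ (fun _ : Bond d (towerP L m (n + 1)) => (1 : 𝔸ˣ)) hL (fun _ => 0) (fun _ => by norm_num)
        (perCfg_UlevOf_one_mem_U1 L m (n + 1)) (norm_Wcx_UlevOf_one_sub_one_le L m (n + 1) (fun _ => 0) (fun _ => le_rfl)) (c₀ := c₀) (c₁ := c₁)) w)
    have h2 := add_le_add (hQ1b w) (hQd w)
    have h3 : Mφ' * Mφ * ‖w‖ + Mφ' * Mφ * (Real.exp (Ξ * (α / (1 - r))) - 1) * ‖w‖ = Mφ' * Mφ * Real.exp (Ξ * (α / (1 - r))) * ‖w‖ := by ring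
    have h4 : Mφ' * Mφ * Real.exp (Ξ * (α / (1 - r))) * ‖w‖ ≤ MQ * ‖w‖ := by
      rw [hMQdef]; exact mul_le_mul_of_nonneg_right (mul_le_mul_of_nonneg_left hexp hMM) (norm_nonneg _)
    linarith
  -- the letters of the port at print's slot `Δ₁ := π_k†Δ^η(U)π_k`, `θ := θ̄α`
  have hK := HK n η hηL hL3 c₀ c₁ hw hρ m U αU hα1 hU1 hreg εU hεU hUε hα0 hαK' hUst hUb hUη hpl hεg hposU hQU
  have hJ := HJ n η hηL hL3 c₀ c₁ hw hρ m U αU hα1 hU1 hreg εU hεU hUε hα0 hαJ' hUst hUb hUη hpl hεg hposU hpos1 hQU hQ1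
  have h1 := H1 n η hηL c₀ c₁ hw hρ m U αU hα1 hU1 hreg εU hεU hUε hα0 hα1' hRS hUb hUη hpl hεg _ hθ0 hθ1 hθ hsymm₁ hpos₁ hposU hQU hCK.le hK.1
  refine ⟨?_, ?_, ?_, ?_⟩
  · -- [G̃]
    intro y
    have hb := H82 n η hηL c₀ c₁ hw hρ m U αU hα1 hU1 hreg εU hεU hUε hα0 hα82' hRS hUb hUη hpl hεg _ hθ0 hθ82 hθ hpos₁ y
    have h5 := (H5 n η hηL c₀ c₁ hw hρ m U αU hα1 hU1 hreg εU hεU hUε hα0 hα5' hRS hUb hUη hpl hεg _ hθ0 hθ5 hθ).2.2 hpos₁ hposU y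
    have hl := (hJ.1 y).2.2.2
    refine ⟨row_mono hb.1 h82C (norm_nonneg _), row_mono hb.2.1 h82C (norm_nonneg _), row_mono hb.2.2 h82C (norm_nonneg _), ?_, ?_, ?_⟩
    · exact row_lin ((norm_sub_le_norm_sub_add_norm_sub _ _ _).trans (add_le_add h5.1 hl.1)) hGC hα0 (norm_nonneg _)
    · exact row_lin ((norm_map_sub_tri _ _ _ _).trans (add_le_add h5.2.1 hl.2.1)) hGC hα0 (norm_nonneg _)
    · exact row_lin ((norm_map_sub_tri _ _ _ _).trans (add_le_add h5.2.2 hl.2.2)) hGC hα0 (norm_nonneg _)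
  · -- [H̃QG̃]
    intro y
    have hm := H83 n η hηL c₀ c₁ hw hρ m U αU hα1 hU1 hreg εU hεU hUε hα0 hα83' hRS hUb hUη hpl hεg _ hθ0 hθ83 hθ hsymm₁ hpos₁ hQU y
    exact ⟨row_mono hm.1 h83C (norm_nonneg _), row_mono hm.2.1 h83C (norm_nonneg _), row_mono hm.2.2 h83C (norm_nonneg _)⟩
  · -- [𝔊̃]
    intro x
    have hb := H84 n η hηL c₀ c₁ hw hρ m U αU hα1 hU1 hreg εU hεU hUε hα0 hα84' hRS hUb hUη hpl hεg _ hθ0 hθ84 hθ hsymm₁ hpos₁ hQU x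
    have hs := HF2 n η hηL c₀ c₁ hw hρ m U αU hα1 hU1 hreg εU hεU hUε hα0 hαF2' hRS hUb hUη hpl hεg _ hθ0 hθF2 hθ hsymm₁ hsymmU hpos₁ hposU hQU
      hK.1 hQUb x
    have hl := (hJ.2.2.1 x).2.2.2
    refine ⟨row_mono hb.1 h84C (norm_nonneg _), row_mono hb.2.1 h84C (norm_nonneg _), row_mono hb.2.2 h84C (norm_nonneg _), ?_, ?_, ?_⟩
    · have h := (norm_sub_le_norm_sub_add_norm_sub _ _ _).trans (add_le_add hs.1 hl.1)
      exact row_lin (A := CF2) (by linarith) h𝔊C hα0 (norm_nonneg _)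
    · have h := (norm_map_sub_tri _ _ _ _).trans (add_le_add hs.2.1 hl.2.1)
      exact row_lin (A := CF2) (by linarith) h𝔊C hα0 (norm_nonneg _)
    · have h := (norm_map_sub_tri _ _ _ _).trans (add_le_add hs.2.2 hl.2.2)
      exact row_lin (A := CF2) (by linarith) h𝔊C hα0 (norm_nonneg _)
  · -- [H̃]
    intro b
    have hr := h1.2 b
    have hs := HF n η hηL c₀ c₁ hw hρ m U αU hα1 hU1 hreg εU hεU hUε hα0 hαF' hRS hUb hUη hpl hεg _ hθ0 hθF hθ hpos₁ hposU hQU hCK.le hK.1 b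
    have hl := (hJ.2.2.2 b).2.2.2
    refine ⟨row_mono hr.1 hHbC (norm_nonneg _), row_mono hr.2.1 hHbC (norm_nonneg _), row_mono hr.2.2 hHbC (norm_nonneg _), ?_, ?_, ?_⟩
    · have h := (norm_sub_le_norm_sub_add_norm_sub _ _ _).trans (add_le_add hs.1 hl.1)
      exact row_lin (A := CF * Real.sqrt CK) (by linarith) hHC hα0 (norm_nonneg _)
    · have h := (norm_map_sub_tri _ _ _ _).trans (add_le_add hs.2.1 hl.2.1)
      exact row_lin (A := CF * Real.sqrt CK) (by linarith) hHC hα0 (norm_nonneg _)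
    · have h := (norm_map_sub_tri _ _ _ _).trans (add_le_add hs.2.2 hl.2.2)
      exact row_lin (A := CF * Real.sqrt CK) (by linarith) hHC hα0 (norm_nonneg _)

end Literature.MathematicalPhysics.QuantumFieldTheory.Balaban1983to89.B9Eq3126EnergyBallTowerPiClosed

end
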